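import Summits.HodgeConjecture.HodgeConjecture.Theorems.Ring2HypothesesDescentStandardBStrictAbelian
import HarnessLib

/-!
# Ring 2 hypotheses, descent face — THE LEFSCHETZ STANDARD CONJECTURE, HOM ≡ NUM AND SEMISIMPLICITY DESCEND ALONG
# SURJECTIVE MORPHISMS of smooth projective complex varieties (`B(Z)` for ONE polarisation ⟹ `B(Y)` for all, `Z ↠ Y`)

research route conditional on HC_CM; not a corollary; Q11.4-sentence-2 already refuted in dim ≥ 3.
Cell `pub-hodge-ring2` (Hodge ladder STAGE 3), seat `ring2-b05` (binder row b05
`Ring2.Hypotheses.MotivatedImpliesAlgebraicAV`), gen 41, sixth file (a corollary sheet of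
`Ring2HypothesesDescentStandardBStrictAbelian` §1 — Arapura's clause `B` from ONE polarisation — with the tree's
`CorCM.Stage4.isDominatedByPowers_of_surjective` / `isDominatedByPowers_self`: Arapura 2006 §1 Cor. 1.2 «`Y` is motivated
by `X` if there exists a surjective morphism `f : Xⁿ → Y`», on the carriers every class of `Y` is `f_* z`, Voisin I
Lemma 7.28 transposed). `HC_CM` (`Theses.RankFourFaces.CMAbelianHodge`) does not occur in this file; nothing here proves a
case of the Hodge conjecture; no binder of `BINDER-OWNERS.md` is discharged; row b05 stays OPEN and is not asserted.
`B⋆(Z, η)` occurs only as a displayed HYPOTHESIS.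

* `standardConjectureBStar_of_surjective_of_standardConjectureBStar` — **for a surjective morphism `f : Z ⟶ Y` of smooth
  projective complex varieties and ONE polarisation class `η` of `Z` with `B⋆(Z, η)`: `B⋆(Y, θ)` for EVERY `θ`** (so, with
  the tree's unconditional instances: every smooth projective image of a variety satisfying `B` satisfies `B` — abelian
  varieties (Lieberman; the companion's `standardConjectureBStar_of_surjective_abelianVariety`), curves, surfaces and their
  powers and products, …);
* `nondegenerate_algebraicClasses_of_surjective_of_standardConjectureBStar` — hom ≡ num on `Y` (both sides, `ℂ`-coefficients);
* `isSemisimpleRing_adjoin_algebraicOperators_of_surjective_of_standardConjectureBStar` — the algebra of algebraic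
  correspondence operators on each `Hᵃ(Y(ℂ); ℂ)` is semisimple;
* `standardConjectureBStar_of_surjective_of_forall` — the all-polarisations form of the first.

HONEST COLUMN. No definition, no named fact, no sorry; kernel implications whose hypothesis `B⋆(Z, η)` is NOT asserted.
In print the inheritance of `B` by dominated varieties is Arapura's Lemma 4.2 with Cor. 1.2 (and Kleiman's product
theorem for the powers); no novelty claimed.

PRESEARCH: [corpus: `paper:arxiv-math_0501348` Arapura 2006 §1 Cor. 1.2, §4 Lemma 4.2, re-opened this session];
corpus hybrid + galaxy `all` as in `Ring2HypothesesDescentStandardDDomination` — certification on the carriers.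

References (bib keys): Arapura2006 (§1 Lemma 1.1, Cor. 1.2, §4 Lemma 4.2), Kleiman1968AlgebraicCycles (Prop. 1.2.4,
Cor. 2.5, Thm. 2.9, §3 Cor. 3.9, Thm. 3.11), VoisinHodgeI2002 (§7.3.2 Lemma 7.28, Rem. 7.29), Jannsen1992 (Thm. 1).
-/

noncomputable section

-- every declaration of this problem lives in `Summit.HodgeConjecture.HodgeConjecture.…` (summit = sub-problem)
set_option linter.dupNamespace false

open CategoryTheory AlgebraicGeometry MonoidalCategory CartesianMonoidalCategory
open Literature.AlgebraicGeometry Literature.AlgebraicGeometry.Motives Literature.AlgebraicGeometry.HodgeTheory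
open Literature.AlgebraicTopology.SingularHomology
open Summit.HodgeConjecture.CorCM.Stage4 (isDominatedByPowers_of_surjective isDominatedByPowers_self)

namespace Summit.HodgeConjecture.HodgeConjecture.Theorems

variable {dZ dY : ℕ} {Z Y : SchemeOver ℂ}

/-- **`B` DESCENDS ALONG SURJECTIVE MORPHISMS.** Let `f : Z ⟶ Y` be a surjective morphism of smooth projective complex
varieties (dimensions `dZ`, `dY`) and `η` a polarisation class of `Z` with `B⋆(Z, η)` (André's `⋆_L`-form, degree-wise).
Then `B⋆(Y, θ)` holds for every `θ ∈ H²(Y(ℂ); ℂ)`: `Y` is dominated by the powers of `Z` through algebraic correspondences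
(`Z` dominates itself, `CorCM.Stage4.isDominatedByPowers_self`; domination descends along `f`,
`CorCM.Stage4.isDominatedByPowers_of_surjective` — every class of `Y` is `f_* z`), and Arapura's clause `B` needs `B⋆` of
ONE polarisation of the dominating variety (companion's `standardConjectureBStar_of_isDominatedByPowers_of_isPolarizationClass`:
Kleiman's product theorem supplies the powers, `B ⟹ A ⟹ D` on them, `D` descends by the transpose argument,
`D(Y ⊗ Y) ⟹ B⋆(Y)`). The hypothesis `B⋆(Z, η)` is NOT asserted. [cite: Arapura2006, §1 Cor. 1.2 and §4 Lemma 4.2]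
[cite: Kleiman1968AlgebraicCycles, Cor. 2.5, Thm. 2.9 and §3 Cor. 3.9] [cite: VoisinHodgeI2002, §7.3.2 Lemma 7.28] -/
theorem standardConjectureBStar_of_surjective_of_standardConjectureBStar (hZ : IsSmoothProjective dZ Z)
    (hY : IsSmoothProjective dY Y) (f : Z ⟶ Y) [AlgebraicGeometry.Surjective f.left] {η : complexBetti Z 2}
    (hη : IsPolarizationClass dZ Z η) (hB : StandardConjectureBStar dZ Z η) (θ : complexBetti Y 2) :
    StandardConjectureBStar dY Y θ :=
  standardConjectureBStar_of_isDominatedByPowers_of_isPolarizationClass hY hZ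
    (isDominatedByPowers_of_surjective hZ hZ hY f (isDominatedByPowers_self hZ)) hη hB θ

/-- **All-polarisations form**: `(∀ η, B⋆(Z, η)) ⟹ ∀ θ, B⋆(Y, θ)` for a surjection `Z ↠ Y` (a polarisation class exists
on `Z`). [cite: Arapura2006, §1 Cor. 1.2 and §4 Lemma 4.2] -/
theorem standardConjectureBStar_of_surjective_of_forall (hZ : IsSmoothProjective dZ Z) (hY : IsSmoothProjective dY Y)
    (f : Z ⟶ Y) [AlgebraicGeometry.Surjective f.left] (hB : ∀ η : complexBetti Z 2, StandardConjectureBStar dZ Z η)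
    (θ : complexBetti Y 2) : StandardConjectureBStar dY Y θ :=
  standardConjectureBStar_of_isDominatedByPowers_of_forall hY hZ
    (isDominatedByPowers_of_surjective hZ hZ hY f (isDominatedByPowers_self hZ)) hB θ

/-- **Hom ≡ num descends along surjective morphisms** (with `ℂ`-coefficients): under `B⋆(Z, η)` for one polarisation
class of the source, the cup pairing on `Nᵖ(Y) × N^q(Y)`, `p + q = dim Y`, is non-degenerate on both sides.
[cite: Arapura2006, §4 Lemma 4.2 (clause D) and §1 Cor. 1.2] [cite: Kleiman1968AlgebraicCycles, §3 Prop. 3.8 and Cor. 3.9] -/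
theorem nondegenerate_algebraicClasses_of_surjective_of_standardConjectureBStar (hZ : IsSmoothProjective dZ Z)
    (hY : IsSmoothProjective dY Y) (f : Z ⟶ Y) [AlgebraicGeometry.Surjective f.left] {η : complexBetti Z 2}
    (hη : IsPolarizationClass dZ Z η) (hB : StandardConjectureBStar dZ Z η) {p q : ℕ} (hpq : p + q = dY) :
    (∀ ξ ∈ algebraicClasses Y p,
        (∀ b ∈ algebraicClasses Y q, cupProduct (show 2 * p + 2 * q = 2 * dY by omega) ξ b = 0) → ξ = 0) ∧
      (∀ b ∈ algebraicClasses Y q,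
        (∀ ξ ∈ algebraicClasses Y p, cupProduct (show 2 * p + 2 * q = 2 * dY by omega) ξ b = 0) → b = 0) :=
  nondegenerate_algebraicClasses_of_isDominatedByPowers_of_isPolarizationClass hY hZ
    (isDominatedByPowers_of_surjective hZ hZ hY f (isDominatedByPowers_self hZ)) hη hB hpq

/-- **Semisimplicity descends along surjective morphisms**: under `B⋆(Z, η)` for one polarisation class of the source,
the algebra of algebraic correspondence operators on each `Hᵃ(Y(ℂ); ℂ)` (actions of the algebraic classes of codimension
`dim Y` on `Y ⊗ Y`, complex orientation family) is a semisimple ring. [cite: Jannsen1992, Thm. 1]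
[cite: Arapura2006, §4 Thm. 4.1 and Lemma 4.2] [cite: Kleiman1968AlgebraicCycles, §3 Thm. 3.11] -/
theorem isSemisimpleRing_adjoin_algebraicOperators_of_surjective_of_standardConjectureBStar
    (hZ : IsSmoothProjective dZ Z) (hY : IsSmoothProjective dY Y) (f : Z ⟶ Y) [AlgebraicGeometry.Surjective f.left]
    {η : complexBetti Z 2} (hη : IsPolarizationClass dZ Z η) (hB : StandardConjectureBStar dZ Z η) (a : ℕ) :
    IsSemisimpleRing (Algebra.adjoin ℂ ((algebraicClasses (Y ⊗ Y) dY).map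
      (corrAction complexOrientationFamily hY hY (rfl : a + 2 * dY = a + 2 * dY)) :
        Set (Module.End ℂ (complexBetti Y a)))) :=
  isSemisimpleRing_adjoin_algebraicOperators_of_isDominatedByPowers hY hZ
    (isDominatedByPowers_of_surjective hZ hZ hY f (isDominatedByPowers_self hZ))
    (fun k θ' ↦ forall_standardConjectureBStar_pow_of_standardConjectureBStar hZ hη hB (k + 1) θ') a

end Summit.HodgeConjecture.HodgeConjecture.Theorems

end
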